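import Summits.QuantumFields.YangMills.Theorems.UnitScaleTiltProp8FibreLiftCurve
import HarnessLib

/-!
# Route `UnitScaleTilt`, crux K1 child «MinimiserStabilityRegPr» (stmt-QuantumFields-19200) — «blend-ℓ²» line (OWNER RULING g24-№1 §B), stub S4
# `firstVariationFibre`, step (iii) ONE LEVEL: **THE VELOCITY OF THE CORRECTED LIFT INTO A ONE-STEP (0.4)-FIBRE DIFFERS FROM THE AMBIENT VELOCITY,
# AT EACH CENTRAL BOND, BY AT MOST `(L^{1−d} − 148·stokesConst·t₀)⁻¹ ×` THE DEFECT VELOCITY OF THE AVERAGE** — the sharp multiplier weight `L^{d−1}`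

Cell `ym3-torus` ∕ width seat `ym-ust-19200-w1` (gen 0; HUMAN RULING D-0037 — YM₃ on T³ is ladder rung R3, not the Clay problem).

WHY.  In the refined S4 plan (HOME STATUS PROGRESS 5–6) the first variation `Lin_U(A)` of an 𝔰𝔲(2)-direction `A` at an R2-critical `U` is, by the
Euler–Lagrange theorem along p2's corrected lift `γ` of the exponential family (`Prop7FirstVariationFibreCurve.abs_lin_le_tree_of_su2`), bounded by
`ε₀L^{−3(K−n)}·Σ_{tree}‖A_b − ξ_b‖`, `ξ` the velocity of `γ`.  What is missing is the SIZE of the corrector velocity `ξ − A` on the tree bonds.  p2's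
lift (`Prop8Criticality.exists_fibre_lift_curve`, p448916 ff.) is qualitative (an implicit-curve argument with the left-inverse constant `|I|⁻¹/2`,
`|I| = L^d(d!)²`), which iterated over `k` levels is not `k`-uniform.  This file proves the A-POSTERIORI, SHARP one-level bound: for ANY bondwise
differentiable family `γ` agreeing with the ambient family `Γ₀` off the central bonds and at `t = 0`, at every coarse bond `c`
`‖γ̇(β c) − Γ̇₀(β c)‖ ≤ (L^{1−d} − 148·stokesConst·t₀)⁻¹ · ‖(d/dt)[γ̄(t)(c) − Γ̄₀(t)(c)]|₀‖`.
The weight `L^{1−d}` is EXACT: it is the fraction `#central/|I| = L(d!)²/(L^d(d!)²)` of the (0.4) index set whose loop variables do not see the central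
bond (`card_filter_isCentral`, `offCentral_ratio_eq`; `|I|` itself is `ApproxLift.card_idx_eq`), i.e. the linear response of the (0.4) average to its central bond at a flat background; the
`148·stokesConst·t₀` is p2's near-identity estimate of the derivative of the exp-mean-log (`norm_fibreCoreDeriv_sub_le`).  Iterated over the levels with
the GEOMETRIC smallness profile of regular fields (`IterPlaqSmallAllL.plaqSmall_iter_T3_allL`) the product of these constants is `≤ 2·L^{(d−1)k}`
uniformly in `k` — the multiplier bound `‖Λ‖_∞ ≤ C·ε₀·L^{−(K−n)}` of the blend-ℓ² card (CARD-19200-V3-g9 §8) — next files.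

WHAT IS PROVED (sorry-free, no definition).  §1 `card_filter_line`, `isCentral_iff`, `card_filter_isCentral`, `offCentral_ratio_eq`
(`#off-central/|I| = 1 − (L^{d−1})⁻¹`).  §2 `mul_star_deriv_mul_eq_neg` (`W₀Ẇ*W₀ = −Ẇ` along a unitary curve).  §3 **`norm_deriv_centralBond_sub_le`**
(the title bound; inputs: p2's private-coordinate normal form `coe_avgFun_update_centralBond`, joint differentiability `differentiableAt_fibreCore_param`,
`fderiv_fibreCore_param_inl`, `norm_fibreCoreDeriv_sub_le`, `eventually_small_of_tendsto`).

HONEST SCOPE.  One averaging step, a-posteriori (no lift is constructed here: p2's `exists_fibre_lift_curve` supplies it).  The `k`-fold product and the T³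
multiplier theorem are the next files.  Count-neutral helper toward stmt-QuantumFields-19200 (`--supports`); nothing continuum ∕ OS ∕ mass-gap ∕ Clay.

References: T. Bałaban, CMP **109** (1987) 249–301 [Balaban1987RG1] ((0.4), (0.11) p.253); CMP **102** (1985) 277–309 [Balaban1985Variational]
((47)–(48) p.287, (127) p.297); CMP **98** (1985) 17–51 [Balaban1985Averaging] (Prop. 3 (122)–(125) p.36).
-/

noncomputable section

open scoped BigOperators Matrix.Norms.L2Operator Matrix Topology
open Filter Function NormedSpace

namespace Summit.QuantumFields.YangMills.Theorems.Prop7FibreVelocity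

open Literature.MathematicalPhysics.QuantumFieldTheory.Balaban1983to89
open T4Continuum AveragingRT BlockAveraging BlockAveragingHaarAC BlockAveragingEMLHaarAC ExpMeanLog
open B7TransferAnalyticMean BlockAveragingEMLAnalyticMean
open Summit.QuantumFields.YangMills.Theorems.BlockAvgCorrector (stokesConst stokesConst_nonneg norm_openHol_mul_star_sub_one_le)
open Summit.QuantumFields.YangMills.Theorems.Prop8Criticality (coe_avgFun_update_centralBond avgFun_eq_avgFun_update_of_agree norm_fibreCoreDeriv_sub_le
  fderiv_fibreCore_param_inl differentiableAt_fibreCore_param differentiableAt_coe_holAt norm_coe_su2 eventually_small_of_tendsto)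

variable {P : Params} {j : ℕ}

/-! ## §1 Counting the central indices of (0.4): `#central/|I| = L^{1−d}` -/

section Count

/-- The block positions on the straight line through the centre in direction `μ` (all other coordinates equal to a fixed `z`) number `L`. [folklore] -/
theorem card_filter_line (μ : Fin P.d) (z : Fin P.L) :
    (Finset.univ.filter fun r : Fin P.d → Fin P.L => ∀ ν, ν ≠ μ → r ν = z).card = P.L := by
  classical
  have himg : (Finset.univ.filter fun r : Fin P.d → Fin P.L => ∀ ν, ν ≠ μ → r ν = z)
      = Finset.univ.image (fun m : Fin P.L => Function.update (fun _ : Fin P.d => z) μ m) := by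
    ext r
    simp only [Finset.mem_filter, Finset.mem_univ, true_and, Finset.mem_image]
    constructor
    · intro h
      refine ⟨r μ, funext fun ν => ?_⟩
      by_cases hν : ν = μ
      · subst hν; rw [Function.update_self]
      · rw [Function.update_of_ne hν, h ν hν]
    · rintro ⟨m, rfl⟩ ν hν
      rw [Function.update_of_ne hν]
  have hinj : Function.Injective (fun m : Fin P.L => Function.update (fun _ : Fin P.d => z) μ m) := by
    intro m m' h
    have := congrFun h μ
    simpa using this
  rw [himg, Finset.card_image_of_injective _ hinj, Finset.card_univ, Fintype.card_fin]

/-- An index `(r, σ, σ′)` of (0.4) is central at `c` iff its block position `r` lies on the line of `c` through the centre. [cite: Balaban1987RG1, (0.4) p.253] -/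
theorem isCentral_iff (c : PBond P (j + 1)) (i : Idx P) :
    IsCentral c i ↔ ∀ ν, ν ≠ c.dir → i.1 ν = ⟨(P.L - 1) / 2, half_lt P⟩ := by
  simp only [IsCentral, off, sub_eq_zero, Nat.cast_inj, Fin.ext_iff]

/-- **`#central = L · |S_d|²`**: the central indices at `c` are the `L` line positions times all pairs of orderings. [cite: Balaban1987RG1, (0.4) p.253] -/
theorem card_filter_isCentral (c : PBond P (j + 1)) :
    (Finset.univ.filter (IsCentral c)).card = P.L * Fintype.card (Equiv.Perm (Fin P.d) × Equiv.Perm (Fin P.d)) := by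
  classical
  have h : Finset.univ.filter (IsCentral c)
      = (Finset.univ.filter fun r : Fin P.d → Fin P.L => ∀ ν, ν ≠ c.dir → r ν = ⟨(P.L - 1) / 2, half_lt P⟩)
          ×ˢ (Finset.univ : Finset (Equiv.Perm (Fin P.d) × Equiv.Perm (Fin P.d))) := by
    rw [← Finset.filter_product_left, Finset.univ_product_univ]
    exact Finset.filter_congr fun i _ => isCentral_iff c i
  rw [h, Finset.card_product, card_filter_line, Finset.card_univ]

/-- **THE OFF-CENTRAL FRACTION OF THE (0.4) INDEX SET IS EXACTLY `1 − L^{1−d}`** (the sharp form of p2's `offCentral_ratio_le`, which only uses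
`≤ 1 − |I|⁻¹`): the linear response of the (0.4) average to its central bond at a flat background is the fraction `L^{1−d}` of loops that are trivial.
[cite: Balaban1987RG1, (0.4) p.253] -/
theorem offCentral_ratio_eq (c : PBond P (j + 1)) :
    (((Finset.univ.filter fun i => ¬ IsCentral c i).card : ℝ)) / (Fintype.card (Idx P) : ℝ) = 1 - (((P.L : ℝ) ^ (P.d - 1)))⁻¹ := by
  classical
  have hsum := Finset.card_filter_add_card_filter_not (s := (Finset.univ : Finset (Idx P))) (p := IsCentral c)
  have card_idx : Fintype.card (Idx P) = P.L ^ P.d * Fintype.card (Equiv.Perm (Fin P.d) × Equiv.Perm (Fin P.d)) := by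
    rw [Fintype.card_prod, Fintype.card_fun, Fintype.card_fin, Fintype.card_fin]
  rw [Finset.card_univ, card_filter_isCentral, card_idx] at hsum
  set N : ℕ := Fintype.card (Equiv.Perm (Fin P.d) × Equiv.Perm (Fin P.d)) with hN
  have hNpos : 0 < N := Fintype.card_pos
  have hL1 : 1 < P.L := P.hL.2
  have hL0 : (0 : ℝ) < P.L := by exact_mod_cast (lt_trans Nat.zero_lt_one hL1)
  have hd : P.L ^ P.d = P.L ^ (P.d - 1) * P.L := by rw [← pow_succ, Nat.sub_add_cancel P.hd]
  have hoffN : (Finset.univ.filter fun i => ¬ IsCentral c i).card = P.L ^ P.d * N - P.L * N := by omega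
  have hle : P.L * N ≤ P.L ^ P.d * N := by
    apply Nat.mul_le_mul_right
    calc P.L = P.L ^ 1 := (pow_one _).symm
      _ ≤ P.L ^ P.d := Nat.pow_le_pow_right (lt_trans Nat.zero_lt_one hL1) P.hd
  rw [hoffN, card_idx, Nat.cast_sub hle, hd]
  push_cast
  have hN0 : (N : ℝ) ≠ 0 := by exact_mod_cast hNpos.ne'
  have hP0 : ((P.L : ℝ) ^ (P.d - 1)) ≠ 0 := pow_ne_zero _ hL0.ne'
  field_simp

end Count

/-! ## §2 Velocities of unitary curves -/

section Unitary

/-- Along a curve of unitaries `W(t)` with velocity `Ẇ` at `0`: `W(0)·Ẇ*·W(0) = −Ẇ` (differentiate `W W* = 1`). [folklore] -/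
theorem mul_star_deriv_mul_eq_neg {W : ℝ → Matrix (Fin 2) (Fin 2) ℂ} {D : Matrix (Fin 2) (Fin 2) ℂ} (hW : HasDerivAt W D 0)
    (hU : ∀ t, W t ∈ Matrix.unitaryGroup (Fin 2) ℂ) : W 0 * star D * W 0 = -D := by
  have h1 : HasDerivAt (fun t => W t * star (W t)) (D * star (W 0) + W 0 * star D) 0 := hW.mul hW.star
  have h2 : HasDerivAt (fun t => W t * star (W t)) 0 0 := by
    have : (fun t => W t * star (W t)) = fun _ => (1 : Matrix (Fin 2) (Fin 2) ℂ) :=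
      funext fun t => Matrix.mem_unitaryGroup_iff.mp (hU t)
    rw [this]; exact hasDerivAt_const _ _
  have h3 : D * star (W 0) + W 0 * star D = 0 := h1.unique h2
  have hWW : star (W 0) * W 0 = 1 := Matrix.mem_unitaryGroup_iff'.mp (hU 0)
  have h4 : W 0 * star D = -(D * star (W 0)) := eq_neg_of_add_eq_zero_right h3
  calc W 0 * star D * W 0 = -(D * star (W 0)) * W 0 := by rw [h4]
    _ = -D := by rw [neg_mul, mul_assoc, hWW, mul_one]

end Unitary

/-! ## §3 The one-step a-posteriori velocity bound at the central bonds -/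

section OneStep

/-- **THE CORRECTOR VELOCITY AT A CENTRAL BOND IS `(L^{1−d} − 148·stokesConst·t₀)⁻¹ ×` THE DEFECT VELOCITY OF THE AVERAGE.**  Let `Γ₀(t)`, `γ(t)` be
bondwise differentiable families of level-`j` `SU(2)` fields with `γ(0) = Γ₀(0)` `t₀`-small (`stokesConst·t₀ ≤ 1/24`, `148·stokesConst·t₀ < L^{1−d}`),
`γ(t) = Γ₀(t)` at every non-central bond for `t` near `0`, and let `Vd`, `A` be the velocities at `t = 0` of `t ↦ γ̄(t)(c)`, `t ↦ Γ̄₀(t)(c)` (the (0.4)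
averages of record, in matrices) at a coarse bond `c`.  Then
`‖γ̇(β c) − Γ̇₀(β c)‖ ≤ (L^{1−d} − 148·stokesConst·t₀)⁻¹ · ‖Vd − A‖`.
PROOF: in the private coordinate `W = pre·U(β c)·post` both averages are `G(W, t) = eml(1 | h_i(t)W^*)·W` (`coe_avgFun_update_centralBond`, the same
off-central data `h_i(t)` for both families); the chain rule gives `∂_W G[Ẇ − Ẇ⁰] = Vd − A`; `∂_W G = X ↦ X + θ·W₀X^*W₀ + O(148v)` (`norm_fibreCoreDeriv_sub_le`)
with `θ = 1 − L^{1−d}` (`offCentral_ratio_eq`), and `W₀X^*W₀ = −X` for the tangent `X = Ẇ − Ẇ⁰` (`mul_star_deriv_mul_eq_neg`).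
[cite: Balaban1987RG1, (0.4) p.253; Balaban1985Variational, (47) p.287, (127) p.297] -/
theorem norm_deriv_centralBond_sub_le [DecidableEq (PBond P j)] (hj : j + 1 ≤ P.m + P.K) {t₀ : ℝ} (ht₀ : 0 < t₀)
    (hv24 : stokesConst P * t₀ ≤ 1 / 24) (hρ : 148 * (stokesConst P * t₀) < (((P.L : ℝ) ^ (P.d - 1)))⁻¹)
    (Γ₀ γ : ℝ → GaugeField P j (Matrix.specialUnitaryGroup (Fin 2) ℂ))
    (hΓ₀diff : ∀ b : PBond P j, DifferentiableAt ℝ (fun t : ℝ => (Γ₀ t b : Matrix (Fin 2) (Fin 2) ℂ)) 0)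
    (hγdiff : ∀ b : PBond P j, DifferentiableAt ℝ (fun t : ℝ => (γ t b : Matrix (Fin 2) (Fin 2) ℂ)) 0)
    (hU₀ : PlaqSmall t₀ (Γ₀ 0)) (hγ0 : γ 0 = Γ₀ 0)
    (hagree : ∀ᶠ t in 𝓝 (0 : ℝ), ∀ b : PBond P j, (∀ c : PBond P (j + 1), centralBond c ≠ b) → γ t b = Γ₀ t b)
    (c : PBond P (j + 1)) {Vd A : Matrix (Fin 2) (Fin 2) ℂ}
    (hVd : HasDerivAt (fun t : ℝ => ((avgFun (expMeanLogSU (n := Fin 2)) (γ t) c : Matrix.specialUnitaryGroup (Fin 2) ℂ) : Matrix (Fin 2) (Fin 2) ℂ)) Vd 0)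
    (hA : HasDerivAt (fun t : ℝ => ((avgFun (expMeanLogSU (n := Fin 2)) (Γ₀ t) c : Matrix.specialUnitaryGroup (Fin 2) ℂ) : Matrix (Fin 2) (Fin 2) ℂ)) A 0) :
    ‖deriv (fun t : ℝ => ((γ t (centralBond c) : Matrix.specialUnitaryGroup (Fin 2) ℂ) : Matrix (Fin 2) (Fin 2) ℂ)) 0
        - deriv (fun t : ℝ => ((Γ₀ t (centralBond c) : Matrix.specialUnitaryGroup (Fin 2) ℂ) : Matrix (Fin 2) (Fin 2) ℂ)) 0‖
      ≤ ((((P.L : ℝ) ^ (P.d - 1)))⁻¹ - 148 * (stokesConst P * t₀))⁻¹ * ‖Vd - A‖ := by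
  classical
  set ℰ : LoopAverage (Matrix.specialUnitaryGroup (Fin 2) ℂ) := expMeanLogSU (n := Fin 2) with hℰ
  have hst : 0 ≤ stokesConst P := stokesConst_nonneg P
  have h2t₀ : stokesConst P * (2 * t₀) < 1 / 3 := by nlinarith
  -- continuity of the two families and of the updated family `Θ(t) = Γ₀(t)[β c ↦ γ(t)(β c)]`
  have hΓ₀cont : ∀ b : PBond P j, Tendsto (fun t : ℝ => (Γ₀ t b : Matrix (Fin 2) (Fin 2) ℂ)) (𝓝 0) (𝓝 (Γ₀ 0 b : Matrix (Fin 2) (Fin 2) ℂ)) :=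
    fun b => (hΓ₀diff b).continuousAt.tendsto
  set Θ : ℝ → GaugeField P j (Matrix.specialUnitaryGroup (Fin 2) ℂ) := fun t => update (Γ₀ t) (centralBond c) (γ t (centralBond c)) with hΘ
  have hΘ0 : Θ 0 = Γ₀ 0 := by simp only [hΘ, hγ0, update_eq_self]
  have hΘcont : ∀ b : PBond P j, Tendsto (fun t : ℝ => (Θ t b : Matrix (Fin 2) (Fin 2) ℂ)) (𝓝 0) (𝓝 (Θ 0 b : Matrix (Fin 2) (Fin 2) ℂ)) := by
    intro b
    by_cases hb : b = centralBond c
    · subst hb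
      have h1 := (hγdiff (centralBond c)).continuousAt.tendsto
      simp only [hΘ, update_self]
      exact h1
    · simp only [hΘ, update_of_ne hb]
      exact hΓ₀cont b
  have hΘU₀ : PlaqSmall t₀ (Θ 0) := by rw [hΘ0]; exact hU₀
  obtain ⟨hΘev, -⟩ := eventually_small_of_tendsto ht₀ h2t₀ hΘU₀ hΘcont
  obtain ⟨hΓev, -⟩ := eventually_small_of_tendsto ht₀ h2t₀ hU₀ hΓ₀cont
  -- the private coordinates of the central bond along the two families, and the guarded fibre map
  set W : ℝ → Matrix (Fin 2) (Fin 2) ℂ := fun t =>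
    ((pre (Γ₀ t) c : Matrix.specialUnitaryGroup (Fin 2) ℂ) : Matrix (Fin 2) (Fin 2) ℂ) * (γ t (centralBond c) : Matrix (Fin 2) (Fin 2) ℂ)
      * ((post (Γ₀ t) c : Matrix.specialUnitaryGroup (Fin 2) ℂ) : Matrix (Fin 2) (Fin 2) ℂ) with hWdef
  set W₀ : ℝ → Matrix (Fin 2) (Fin 2) ℂ := fun t =>
    ((pre (Γ₀ t) c : Matrix.specialUnitaryGroup (Fin 2) ℂ) : Matrix (Fin 2) (Fin 2) ℂ) * (Γ₀ t (centralBond c) : Matrix (Fin 2) (Fin 2) ℂ)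
      * ((post (Γ₀ t) c : Matrix.specialUnitaryGroup (Fin 2) ℂ) : Matrix (Fin 2) (Fin 2) ℂ) with hW₀def
  set G : Matrix (Fin 2) (Fin 2) ℂ × ℝ → Matrix (Fin 2) (Fin 2) ℂ := fun p =>
    eml (fun i => if IsCentral c i then (1 : Matrix (Fin 2) (Fin 2) ℂ) else
      ((openHol (Γ₀ p.2) c i : Matrix.specialUnitaryGroup (Fin 2) ℂ) : Matrix (Fin 2) (Fin 2) ℂ) * star p.1) * p.1 with hGdef
  have hW00 : W 0 = W₀ 0 := by simp only [hWdef, hW₀def, hγ0]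
  have hW₀ax : ∀ t, W₀ t = ((axialAvg (Γ₀ t) c : Matrix.specialUnitaryGroup (Fin 2) ℂ) : Matrix (Fin 2) (Fin 2) ℂ) := fun t => by
    rw [hW₀def, axialAvg_eq_pre_mul_mul_post, Submonoid.coe_mul, Submonoid.coe_mul]
  have hWu : ∀ t, W t ∈ Matrix.unitaryGroup (Fin 2) ℂ := fun t => by
    rw [hWdef]; exact (pre (Γ₀ t) c * γ t (centralBond c) * post (Γ₀ t) c).2.1
  have hW₀u : ∀ t, W₀ t ∈ Matrix.unitaryGroup (Fin 2) ℂ := fun t => by rw [hW₀ax]; exact (axialAvg (Γ₀ t) c).2.1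
  -- both averages in the private coordinate, near `t = 0`
  have hGW : ∀ᶠ t in 𝓝 (0 : ℝ), G (W t, t) = ((avgFun ℰ (γ t) c : Matrix.specialUnitaryGroup (Fin 2) ℂ) : Matrix (Fin 2) (Fin 2) ℂ) := by
    filter_upwards [hagree, hΘev] with t hag hΘt
    rw [avgFun_eq_avgFun_update_of_agree hj ℰ (Γ₀ t) (γ t) c hag, hℰ, coe_avgFun_update_centralBond hj (Γ₀ t) c (γ t (centralBond c)) (hΘt.2 c)]
  have hGW₀ : ∀ᶠ t in 𝓝 (0 : ℝ), G (W₀ t, t) = ((avgFun ℰ (Γ₀ t) c : Matrix.specialUnitaryGroup (Fin 2) ℂ) : Matrix (Fin 2) (Fin 2) ℂ) := by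
    filter_upwards [hΓev] with t hΓt
    have hsm : Small (expMeanLogSU (n := Fin 2)) (update (Γ₀ t) (centralBond c) (Γ₀ t (centralBond c))) c := by
      rw [update_eq_self]; exact hΓt.2 c
    have h1 := coe_avgFun_update_centralBond hj (Γ₀ t) c (Γ₀ t (centralBond c)) hsm
    rw [update_eq_self] at h1
    rw [hℰ, h1]
  -- differentiability of the transports, of the central bonds, of the coordinates
  have hprediff : DifferentiableAt ℝ (fun t : ℝ => ((pre (Γ₀ t) c : Matrix.specialUnitaryGroup (Fin 2) ℂ) : Matrix (Fin 2) (Fin 2) ℂ)) 0 := by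
    unfold BlockAveragingHaarAC.pre; exact differentiableAt_coe_holAt hΓ₀diff _
  have hpostdiff : DifferentiableAt ℝ (fun t : ℝ => ((post (Γ₀ t) c : Matrix.specialUnitaryGroup (Fin 2) ℂ) : Matrix (Fin 2) (Fin 2) ℂ)) 0 := by
    unfold BlockAveragingHaarAC.post; exact differentiableAt_coe_holAt hΓ₀diff _
  have hopendiff : ∀ i, DifferentiableAt ℝ (fun t : ℝ => ((openHol (Γ₀ t) c i : Matrix.specialUnitaryGroup (Fin 2) ℂ) : Matrix (Fin 2) (Fin 2) ℂ)) 0 := fun i => by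
    unfold BlockAveragingHaarAC.openHol; exact differentiableAt_coe_holAt hΓ₀diff _
  set D₁ : Matrix (Fin 2) (Fin 2) ℂ := deriv (fun t : ℝ => ((γ t (centralBond c) : Matrix.specialUnitaryGroup (Fin 2) ℂ) : Matrix (Fin 2) (Fin 2) ℂ)) 0 with hD₁
  set D₀ : Matrix (Fin 2) (Fin 2) ℂ := deriv (fun t : ℝ => ((Γ₀ t (centralBond c) : Matrix.specialUnitaryGroup (Fin 2) ℂ) : Matrix (Fin 2) (Fin 2) ℂ)) 0 with hD₀
  set Dpre : Matrix (Fin 2) (Fin 2) ℂ := deriv (fun t : ℝ => ((pre (Γ₀ t) c : Matrix.specialUnitaryGroup (Fin 2) ℂ) : Matrix (Fin 2) (Fin 2) ℂ)) 0 with hDpre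
  set Dpost : Matrix (Fin 2) (Fin 2) ℂ := deriv (fun t : ℝ => ((post (Γ₀ t) c : Matrix.specialUnitaryGroup (Fin 2) ℂ) : Matrix (Fin 2) (Fin 2) ℂ)) 0 with hDpost
  have hγβ : HasDerivAt (fun t : ℝ => ((γ t (centralBond c) : Matrix.specialUnitaryGroup (Fin 2) ℂ) : Matrix (Fin 2) (Fin 2) ℂ)) D₁ 0 :=
    (hγdiff (centralBond c)).hasDerivAt
  have hΓβ : HasDerivAt (fun t : ℝ => ((Γ₀ t (centralBond c) : Matrix.specialUnitaryGroup (Fin 2) ℂ) : Matrix (Fin 2) (Fin 2) ℂ)) D₀ 0 :=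
    (hΓ₀diff (centralBond c)).hasDerivAt
  have hpre := hprediff.hasDerivAt
  have hpost := hpostdiff.hasDerivAt
  set p₀ : Matrix (Fin 2) (Fin 2) ℂ := ((pre (Γ₀ 0) c : Matrix.specialUnitaryGroup (Fin 2) ℂ) : Matrix (Fin 2) (Fin 2) ℂ) with hp₀
  set q₀ : Matrix (Fin 2) (Fin 2) ℂ := ((post (Γ₀ 0) c : Matrix.specialUnitaryGroup (Fin 2) ℂ) : Matrix (Fin 2) (Fin 2) ℂ) with hq₀
  set g₀ : Matrix (Fin 2) (Fin 2) ℂ := ((Γ₀ 0 (centralBond c) : Matrix.specialUnitaryGroup (Fin 2) ℂ) : Matrix (Fin 2) (Fin 2) ℂ) with hg₀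
  have hg₀' : ((γ 0 (centralBond c) : Matrix.specialUnitaryGroup (Fin 2) ℂ) : Matrix (Fin 2) (Fin 2) ℂ) = g₀ := by rw [hg₀, hγ0]
  have hWd : HasDerivAt W (Dpre * g₀ * q₀ + p₀ * D₁ * q₀ + p₀ * g₀ * Dpost) 0 := by
    have h1 : HasDerivAt W (((Dpre * ((γ 0 (centralBond c) : Matrix.specialUnitaryGroup (Fin 2) ℂ) : Matrix (Fin 2) (Fin 2) ℂ) + p₀ * D₁) * q₀
        + p₀ * ((γ 0 (centralBond c) : Matrix.specialUnitaryGroup (Fin 2) ℂ) : Matrix (Fin 2) (Fin 2) ℂ) * Dpost)) 0 := (hpre.mul hγβ).mul hpost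
    refine h1.congr_deriv ?_
    rw [hg₀']
    noncomm_ring
  have hW₀d : HasDerivAt W₀ (Dpre * g₀ * q₀ + p₀ * D₀ * q₀ + p₀ * g₀ * Dpost) 0 := by
    have h1 : HasDerivAt W₀ (((Dpre * g₀ + p₀ * D₀) * q₀ + p₀ * g₀ * Dpost)) 0 := (hpre.mul hΓβ).mul hpost
    refine h1.congr_deriv ?_
    noncomm_ring
  set X : Matrix (Fin 2) (Fin 2) ℂ := (Dpre * g₀ * q₀ + p₀ * D₁ * q₀ + p₀ * g₀ * Dpost) - (Dpre * g₀ * q₀ + p₀ * D₀ * q₀ + p₀ * g₀ * Dpost) with hXdef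
  have hXeq : X = p₀ * (D₁ - D₀) * q₀ := by rw [hXdef]; noncomm_ring
  have hp₀u : p₀ ∈ Matrix.unitaryGroup (Fin 2) ℂ := (pre (Γ₀ 0) c).2.1
  have hq₀u : q₀ ∈ Matrix.unitaryGroup (Fin 2) ℂ := (post (Γ₀ 0) c).2.1
  have hXnorm : ‖X‖ = ‖D₁ - D₀‖ := by
    rw [hXeq, CStarRing.norm_mul_mem_unitary _ hq₀u, CStarRing.norm_mem_unitary_mul _ hp₀u]
  -- tangency: `W(0) X^* W(0) = −X`
  have htan : W 0 * star X * W 0 = -X := by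
    have h1 := mul_star_deriv_mul_eq_neg hWd hWu
    have h2 := mul_star_deriv_mul_eq_neg hW₀d hW₀u
    rw [← hW00] at h2
    rw [hXdef, star_sub, mul_sub, sub_mul, h1, h2, neg_sub_neg, neg_sub]
  -- the polydisc conditions at `t = 0`
  have hhu : ∀ i, ¬ IsCentral c i →
      ((openHol (Γ₀ 0) c i : Matrix.specialUnitaryGroup (Fin 2) ℂ) : Matrix (Fin 2) (Fin 2) ℂ) ∈ Matrix.unitaryGroup (Fin 2) ℂ :=
    fun i _ => (openHol (Γ₀ 0) c i).2.1
  have hTi : ∀ i, ‖(if IsCentral c i then (1 : Matrix (Fin 2) (Fin 2) ℂ) else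
      ((openHol (Γ₀ 0) c i : Matrix.specialUnitaryGroup (Fin 2) ℂ) : Matrix (Fin 2) (Fin 2) ℂ) * star (W 0)) - 1‖ ≤ stokesConst P * t₀ := by
    intro i
    split_ifs with hc
    · rw [sub_self, norm_zero]; positivity
    · rw [hW00, hW₀ax]; exact norm_openHol_mul_star_sub_one_le ht₀.le hU₀ c i
  have hTsup : ‖(fun i => if IsCentral c i then (1 : Matrix (Fin 2) (Fin 2) ℂ) else
      ((openHol (Γ₀ 0) c i : Matrix.specialUnitaryGroup (Fin 2) ℂ) : Matrix (Fin 2) (Fin 2) ℂ) * star (W 0)) - 1‖ ≤ stokesConst P * t₀ := by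
    refine (pi_norm_le_iff_of_nonneg (by positivity)).mpr fun i => ?_
    rw [Pi.sub_apply, Pi.one_apply]; exact hTi i
  have hT13 : ‖(fun i => if IsCentral c i then (1 : Matrix (Fin 2) (Fin 2) ℂ) else
      ((openHol (Γ₀ 0) c i : Matrix.specialUnitaryGroup (Fin 2) ℂ) : Matrix (Fin 2) (Fin 2) ℂ) * star (W 0)) - 1‖ < 1 / 3 :=
    hTsup.trans_lt (by linarith)
  have hT1 : ∀ i, ‖(if IsCentral c i then (1 : Matrix (Fin 2) (Fin 2) ℂ) else
      ((openHol (Γ₀ 0) c i : Matrix.specialUnitaryGroup (Fin 2) ℂ) : Matrix (Fin 2) (Fin 2) ℂ) * star (W 0)) - 1‖ < 1 :=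
    fun i => (hTi i).trans_lt (by linarith)
  -- the chain rule along `t ↦ (W t, t)` and `t ↦ (W₀ t, t)`
  have hGd : DifferentiableAt ℝ G (W 0, 0) := by
    rw [hGdef]
    exact differentiableAt_fibreCore_param (IsCentral c)
      (fun t i => ((openHol (Γ₀ t) c i : Matrix.specialUnitaryGroup (Fin 2) ℂ) : Matrix (Fin 2) (Fin 2) ℂ)) (W 0) hopendiff hT1
  have hcurve : HasDerivAt (fun t : ℝ => ((W t, t) : Matrix (Fin 2) (Fin 2) ℂ × ℝ))
      ((Dpre * g₀ * q₀ + p₀ * D₁ * q₀ + p₀ * g₀ * Dpost, 1) : Matrix (Fin 2) (Fin 2) ℂ × ℝ) 0 := hWd.prodMk (hasDerivAt_id (0 : ℝ))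
  have hcurve₀ : HasDerivAt (fun t : ℝ => ((W₀ t, t) : Matrix (Fin 2) (Fin 2) ℂ × ℝ))
      ((Dpre * g₀ * q₀ + p₀ * D₀ * q₀ + p₀ * g₀ * Dpost, 1) : Matrix (Fin 2) (Fin 2) ℂ × ℝ) 0 := hW₀d.prodMk (hasDerivAt_id (0 : ℝ))
  have hcomp : HasDerivAt (fun t : ℝ => G (W t, t))
      (fderiv ℝ G (W 0, 0) (Dpre * g₀ * q₀ + p₀ * D₁ * q₀ + p₀ * g₀ * Dpost, 1)) 0 :=
    hGd.hasFDerivAt.comp_hasDerivAt_of_eq (0 : ℝ) hcurve rfl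
  have hcomp₀ : HasDerivAt (fun t : ℝ => G (W₀ t, t))
      (fderiv ℝ G (W 0, 0) (Dpre * g₀ * q₀ + p₀ * D₀ * q₀ + p₀ * g₀ * Dpost, 1)) 0 :=
    hGd.hasFDerivAt.comp_hasDerivAt_of_eq (0 : ℝ) hcurve₀ (by rw [hW00])
  have h1 : fderiv ℝ G (W 0, 0) (Dpre * g₀ * q₀ + p₀ * D₁ * q₀ + p₀ * g₀ * Dpost, 1) = Vd :=
    (hcomp.congr_of_eventuallyEq (hGW.mono fun t ht => ht.symm)).unique hVd
  have h2 : fderiv ℝ G (W 0, 0) (Dpre * g₀ * q₀ + p₀ * D₀ * q₀ + p₀ * g₀ * Dpost, 1) = A :=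
    (hcomp₀.congr_of_eventuallyEq (hGW₀.mono fun t ht => ht.symm)).unique hA
  have h3 : fderiv ℝ G (W 0, 0) (X, 0) = Vd - A := by
    rw [← h1, ← h2, ← map_sub, Prod.mk_sub_mk, sub_self]
  -- the explicit partial derivative and its near-identity estimate
  have hinl := fderiv_fibreCore_param_inl (IsCentral c)
    (fun t i => ((openHol (Γ₀ t) c i : Matrix.specialUnitaryGroup (Fin 2) ℂ) : Matrix (Fin 2) (Fin 2) ℂ)) (W 0) hopendiff hT13 X
  have hest := norm_fibreCoreDeriv_sub_le (IsCentral c)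
    (fun i => ((openHol (Γ₀ 0) c i : Matrix.specialUnitaryGroup (Fin 2) ℂ) : Matrix (Fin 2) (Fin 2) ℂ)) hhu (hWu 0) X hTsup hv24
  -- the ratio `θ = 1 − L^{1−d}`
  set ρ : ℝ := (((P.L : ℝ) ^ (P.d - 1)))⁻¹ with hρdef
  have hρ0 : 0 ≤ ρ := by rw [hρdef]; positivity
  have hθ : ((((Finset.univ.filter fun i => ¬ IsCentral c i).card : ℝ)) : ℂ) / ((Fintype.card (Idx P) : ℝ) : ℂ) = (((1 - ρ) : ℝ) : ℂ) := by
    rw [← Complex.ofReal_div, offCentral_ratio_eq c]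
  have hmain : (ρ - 148 * (stokesConst P * t₀)) * ‖X‖ ≤ ‖Vd - A‖ := by
    have hAX : ‖Vd - A‖ = ‖fderiv ℂ (eml : (Idx P → Matrix (Fin 2) (Fin 2) ℂ) → Matrix (Fin 2) (Fin 2) ℂ)
        (fun i => if IsCentral c i then (1 : Matrix (Fin 2) (Fin 2) ℂ) else
          ((openHol (Γ₀ 0) c i : Matrix.specialUnitaryGroup (Fin 2) ℂ) : Matrix (Fin 2) (Fin 2) ℂ) * star (W 0))
        (fun i => if IsCentral c i then (0 : Matrix (Fin 2) (Fin 2) ℂ) else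
          ((openHol (Γ₀ 0) c i : Matrix.specialUnitaryGroup (Fin 2) ℂ) : Matrix (Fin 2) (Fin 2) ℂ) * star X) * W 0
        + eml (fun i => if IsCentral c i then (1 : Matrix (Fin 2) (Fin 2) ℂ) else
          ((openHol (Γ₀ 0) c i : Matrix.specialUnitaryGroup (Fin 2) ℂ) : Matrix (Fin 2) (Fin 2) ℂ) * star (W 0)) * X‖ := by
      rw [← h3, hinl]
    have e1 : X + ((((Finset.univ.filter fun i => ¬ IsCentral c i).card : ℝ) : ℂ) / ((Fintype.card (Idx P) : ℝ) : ℂ)) • (W 0 * star X * W 0)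
        = ((ρ : ℝ) : ℂ) • X := by
      rw [hθ, htan, smul_neg, ← sub_eq_add_neg, Complex.ofReal_sub, Complex.ofReal_one, sub_smul, one_smul, sub_sub_cancel]
    rw [e1] at hest
    have e2 : ‖((ρ : ℝ) : ℂ) • X‖ = ρ * ‖X‖ := by rw [norm_smul, Complex.norm_real, Real.norm_of_nonneg hρ0]
    have e3 := norm_sub_norm_le (((ρ : ℝ) : ℂ) • X) (fderiv ℂ (eml : (Idx P → Matrix (Fin 2) (Fin 2) ℂ) → Matrix (Fin 2) (Fin 2) ℂ)
        (fun i => if IsCentral c i then (1 : Matrix (Fin 2) (Fin 2) ℂ) else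
          ((openHol (Γ₀ 0) c i : Matrix.specialUnitaryGroup (Fin 2) ℂ) : Matrix (Fin 2) (Fin 2) ℂ) * star (W 0))
        (fun i => if IsCentral c i then (0 : Matrix (Fin 2) (Fin 2) ℂ) else
          ((openHol (Γ₀ 0) c i : Matrix.specialUnitaryGroup (Fin 2) ℂ) : Matrix (Fin 2) (Fin 2) ℂ) * star X) * W 0
        + eml (fun i => if IsCentral c i then (1 : Matrix (Fin 2) (Fin 2) ℂ) else
          ((openHol (Γ₀ 0) c i : Matrix.specialUnitaryGroup (Fin 2) ℂ) : Matrix (Fin 2) (Fin 2) ℂ) * star (W 0)) * X)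
    rw [norm_sub_rev] at e3
    rw [hAX, sub_mul, e2.symm]
    linarith
  -- conclusion
  have hpos : 0 < ρ - 148 * (stokesConst P * t₀) := by rw [hρdef]; linarith
  rw [← hXnorm, ← div_eq_inv_mul, le_div_iff₀ hpos, mul_comm]
  exact hmain

end OneStep

end Summit.QuantumFields.YangMills.Theorems.Prop7FibreVelocity

end
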